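import Mathlib

/-!
# STUB-IDEAS k2 (gen 20) — sketch for `stub_heegnerIndexLowerAtTwo`
(crux `PrintCf2.SplitBadTwoLowerHalfOfFacts`, stmt-BirchSwinnertonDyer-27851; STUB-PLAN v4.0 ORDER-NOW **R140**).

**R140 closed by TRANSPORT.**  Liu–S. Zhang–W. Zhang's p-adic Waldspurger theorem is
`Lie A⁺ ⊗ Lie A⁻`-valued (arXiv:1511.08172 Thm 3.8 / Thm 3.10, p. 18): no differential is chosen.
For ANY realisation `Φ : A_ξ → W` (the good pair of T3.1) transport

* the Mordell–Weil pair by `(Φ, Φ^∨ ∘ λ_W)`  :  `z⁺ = Φ y`,  `y^∨ = Φ^∨ (λ_W z⁻)`;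
* the differential pair by `(Φ^*, ((Φ^∨)^*)⁻¹)` :  `ω₊ = Φ^* ω_W`,  `(Φ^∨)^* ω₋ = ω_{W^∨}`.

Three EXACT adjunctions — Néron–Tate (Bombieri–Gubler Prop. 9.3.6 + (9.5) + Thm 9.2.7),
formal logarithm (`log_{Φ^*η} = log_η ∘ Φ`), de Rham / Hodge (`⟨Φ^*α, β⟩_A = ⟨α, (Φ^∨)^*β⟩_W`) —
then show:

* (§A) the weight-0 side of the S2′ ledger is `ℓ(z⁺)·ℓ(z⁻)/B_W(z⁺, λ z⁻)` with projector constant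
  `c₊c₋/δ = 1` — no degree, no Manin constant, no `r_ξ`, no `h_ξ` (`quotient_transport`);
  it depends only on the two LINES through `z⁺, z⁻` (`wQuot_smul_left/right`);
* (§B) the interpolation constant `C_ι` (k2-g9: `C_ι = κ·Γ_k·Hodge_A(ω₊,ω₋)`) becomes, in the
  transported gauge, `κ·Γ_k·Hodge_W(ω_W, ω_{W^∨}) = κ·Γ_k·cov(W, ω_W)` for EVERY `Φ`
  (`periodConstant_transport`, `cIota_transport`), and is unchanged under `Φ ↦ c•Φ`
  (`periodConstant_gauge`);
* (§C) integer bookkeeping: the covolume column of the minimal twist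
  (`cov(W_d) = cov(cm7)/(4|d|)`) reproduces k2-g18's depth slope, key-freeness given `γ₁ = 1`
  is manifest (`eA_keyFree_of_gamma1`), the YZZ/LZZ elementary constants cancel to
  `2^{g-1} δ_E^{1/2} = √7` (`elementary_ratio_g_one`, `v2_cGZ`), and k3-g19's three-term acceptance
  test collapses to a two-term one (`acceptance_two_term`).

Everything here is Mathlib-only linear algebra / arithmetic: it CHECKS THE DICTIONARY, it proves
nothing about elliptic curves.  BSD is NOT proved; the crux and the stub are NOT proved.
-/

set_option linter.dupNamespace false

namespace Summit.BirchSwinnertonDyer.BirchSwinnertonDyer.Cruxes.SplitBadTwoLowerHalfOfFacts.StubIdeasK2G20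

/-! ## §A  Mordell–Weil transport: the projector constant is `1` -/

section MW

variable {F : Type*} [Field F]
variable {VB VBd VW VWd : Type*}
  [AddCommGroup VB] [Module F VB] [AddCommGroup VBd] [Module F VBd]
  [AddCommGroup VW] [Module F VW] [AddCommGroup VWd] [Module F VWd]

/-- The transport datum of a realisation `Φ : A → W` on (`F`-linearised) Mordell–Weil spaces:
`Φ` on points, `Φd = Φ^∨` on points of the duals, `lam = λ_W` the polarisation of `W`,
`BB`, `BW` the Néron–Tate POINCARÉ pairings `A × A^∨ → F`, `W × W^∨ → F`, and the one axiom
`adjNT` = functoriality of the Poincaré-class height (Bombieri–Gubler 9.3.6, (9.5), 9.2.7). -/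
structure MWTransport (F VB VBd VW VWd : Type*) [Field F]
    [AddCommGroup VB] [Module F VB] [AddCommGroup VBd] [Module F VBd]
    [AddCommGroup VW] [Module F VW] [AddCommGroup VWd] [Module F VWd] where
  Φ : VB →ₗ[F] VW
  Φd : VWd →ₗ[F] VBd
  lam : VW →ₗ[F] VWd
  BB : VB →ₗ[F] VBd →ₗ[F] F
  BW : VW →ₗ[F] VWd →ₗ[F] F
  adjNT : ∀ (y : VB) (w : VWd), BW (Φ y) w = BB y (Φd w)

variable (T : MWTransport F VB VBd VW VWd)

/-- Height transport: if `y^∨ = Φ^∨(λ z⁻)` then `⟨y, y^∨⟩_A = B_W(Φ y, z⁻)`; NO degree appears. -/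
theorem height_transport (y : VB) (zm : VW) (yd : VBd) (hyd : yd = T.Φd (T.lam zm)) :
    T.BB y yd = T.BW (T.Φ y) (T.lam zm) := by
  rw [hyd, ← T.adjNT]

/-- Log transport on the `+` side is a DEFINITION: `log_{Φ^*ω_W} := log_{ω_W} ∘ Φ`. -/
def logPlus (ℓW : VW →ₗ[F] F) : VB →ₗ[F] F := ℓW ∘ₗ T.Φ

@[simp] theorem logPlus_apply (ℓW : VW →ₗ[F] F) (y : VB) :
    logPlus T ℓW y = ℓW (T.Φ y) := rfl

/-- The transported weight-0 quotient on `A` equals the intrinsic quotient on `W`: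
`log_{ω₊}(y)·log_{ω₋}(y^∨)/⟨y,y^∨⟩_A = ℓ(z⁺)·ℓ⁻(z⁻)/B_W(z⁺, λ z⁻)` with `z⁺ = Φ y`,
`y^∨ = Φ^∨ λ z⁻`, `ω₊ = Φ^*ω_W` and `ω₋` chosen with `(Φ^∨ ∘ λ)^* ω₋ = ω_W⁻`
(hypothesis `hlogm`).  The projector constant `c₊ c₋ / δ` of k1-g18 is literally `1`. -/
theorem quotient_transport (ℓW ℓWm : VW →ₗ[F] F) (ℓBm : VBd →ₗ[F] F)
    (hlogm : ℓBm ∘ₗ T.Φd ∘ₗ T.lam = ℓWm)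
    (y : VB) (zm : VW) (yd : VBd) (hyd : yd = T.Φd (T.lam zm)) :
    logPlus T ℓW y * ℓBm yd / T.BB y yd
      = ℓW (T.Φ y) * ℓWm zm / T.BW (T.Φ y) (T.lam zm) := by
  have h1 : ℓBm yd = ℓWm zm := by
    rw [hyd, ← hlogm]; rfl
  rw [logPlus_apply, h1, height_transport T y zm yd hyd]

/-- The intrinsic `W`-quotient. -/
def wQuot (B : VW →ₗ[F] VWd →ₗ[F] F) (lam : VW →ₗ[F] VWd) (ℓ ℓm : VW →ₗ[F] F)
    (zp zm : VW) : F :=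
  ℓ zp * ℓm zm / B zp (lam zm)

/-- It depends only on the LINE through `z⁺` … -/
theorem wQuot_smul_left (B : VW →ₗ[F] VWd →ₗ[F] F) (lam : VW →ₗ[F] VWd) (ℓ ℓm : VW →ₗ[F] F)
    (zp zm : VW) (a : F) (ha : a ≠ 0) :
    wQuot B lam ℓ ℓm (a • zp) zm = wQuot B lam ℓ ℓm zp zm := by
  unfold wQuot
  simp only [map_smul, LinearMap.smul_apply, smul_eq_mul]
  by_cases hB : B zp (lam zm) = 0
  · simp [hB]
  · field_simp

/-- … and only on the LINE through `z⁻`: so the good pair `(A_ξ, Φ)` is invisible at weight 0. -/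
theorem wQuot_smul_right (B : VW →ₗ[F] VWd →ₗ[F] F) (lam : VW →ₗ[F] VWd) (ℓ ℓm : VW →ₗ[F] F)
    (zp zm : VW) (b : F) (hb : b ≠ 0) :
    wQuot B lam ℓ ℓm zp (b • zm) = wQuot B lam ℓ ℓm zp zm := by
  unfold wQuot
  simp only [map_smul, smul_eq_mul]
  by_cases hB : B zp (lam zm) = 0
  · simp [hB]
  · field_simp

/-- Rescaling the realisation `Φ ↦ c • Φ` (hence `Φ^∨ ↦ c • Φ^∨`) preserves the adjunction. -/
def MWTransport.rescale (c : F) : MWTransport F VB VBd VW VWd where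
  Φ := c • T.Φ
  Φd := c • T.Φd
  lam := T.lam
  BB := T.BB
  BW := T.BW
  adjNT := by
    intro y w
    simp only [LinearMap.smul_apply, map_smul, smul_eq_mul, T.adjNT]

/-- Gauge check: with `Φ ↦ c•Φ` the transported quotient is computed at `z⁺ = c•Φy`,
and by `wQuot_smul_left` it is the same number. -/
theorem quotient_gauge (ℓW ℓWm : VW →ₗ[F] F) (y : VB) (zm : VW) (c : F) (hc : c ≠ 0) :
    wQuot T.BW T.lam ℓW ℓWm ((T.rescale c).Φ y) zm = wQuot T.BW T.lam ℓW ℓWm (T.Φ y) zm := by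
  show wQuot T.BW T.lam ℓW ℓWm ((c • T.Φ) y) zm = _
  rw [LinearMap.smul_apply]
  exact wQuot_smul_left T.BW T.lam ℓW ℓWm (T.Φ y) zm c hc

end MW

/-! ## §B  Hodge transport: `C_ι` in the transported gauge is the covolume of `W` -/

section Hodge

variable {F : Type*} [Field F]
variable {ΩB ΩBd ΩW ΩWd : Type*}
  [AddCommGroup ΩB] [Module F ΩB] [AddCommGroup ΩBd] [Module F ΩBd]
  [AddCommGroup ΩW] [Module F ΩW] [AddCommGroup ΩWd] [Module F ΩWd]

/-- de Rham transport datum: `Φstar = Φ^*` on invariant differentials `Ω(W) → Ω(A)`,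
`Φdstar = (Φ^∨)^*` on `Ω(A^∨) → Ω(W^∨)`, the Hodge pairings `HB : Ω(A) × Ω(A^∨) → F`,
`HW : Ω(W) × Ω(W^∨) → F`, and the projection formula `adjDR`. -/
structure DRTransport (F ΩB ΩBd ΩW ΩWd : Type*) [Field F]
    [AddCommGroup ΩB] [Module F ΩB] [AddCommGroup ΩBd] [Module F ΩBd]
    [AddCommGroup ΩW] [Module F ΩW] [AddCommGroup ΩWd] [Module F ΩWd] where
  Φstar : ΩW →ₗ[F] ΩB
  Φdstar : ΩBd →ₗ[F] ΩWd
  HB : ΩB →ₗ[F] ΩBd →ₗ[F] F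
  HW : ΩW →ₗ[F] ΩWd →ₗ[F] F
  adjDR : ∀ (α : ΩW) (β : ΩBd), HB (Φstar α) β = HW α (Φdstar β)

variable (D : DRTransport F ΩB ΩBd ΩW ΩWd)

/-- Period-constant transport: with `ω₊ = Φ^*ω_W` and `ω₋` such that `(Φ^∨)^*ω₋ = ω_{W^∨}`,
`Hodge_A(ω₊, ω₋) = Hodge_W(ω_W, ω_{W^∨})` — the covolume of `(W, ω_W)`, for EVERY `Φ`. -/
theorem periodConstant_transport (ωW : ΩW) (ωWd : ΩWd) (ωm : ΩBd)
    (hm : D.Φdstar ωm = ωWd) :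
    D.HB (D.Φstar ωW) ωm = D.HW ωW ωWd := by
  rw [D.adjDR, hm]

/-- The kernel directions of `(Φ^∨)^*` (the other eigenlines of `A^∨`) do not pair with `Φ^*ω_W`:
the transported `C_ι` is well defined although `ω₋` is only determined modulo `ker (Φ^∨)^*`. -/
theorem periodConstant_wellDefined (ωW : ΩW) (ωm ωm' : ΩBd)
    (h : D.Φdstar ωm = D.Φdstar ωm') :
    D.HB (D.Φstar ωW) ωm = D.HB (D.Φstar ωW) ωm' := by
  rw [D.adjDR, D.adjDR, h]

/-- k2-g9's projection-formula shape `C_ι(ω₊,ω₋) = κ · Γ_k · Hodge_A(ω₊,ω₋)` transported: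
`C_ι^{tr} = κ · Γ_k · cov(W, ω_W)`; no `r_ξ`, no `h_ξ`, no degree of `Φ`. -/
theorem cIota_transport (κ Γk : F) (CIota : ΩB → ΩBd → F)
    (hproj : ∀ a b, CIota a b = κ * Γk * D.HB a b)
    (ωW : ΩW) (ωWd : ΩWd) (ωm : ΩBd) (hm : D.Φdstar ωm = ωWd) :
    CIota (D.Φstar ωW) ωm = κ * Γk * D.HW ωW ωWd := by
  rw [hproj, periodConstant_transport D ωW ωWd ωm hm]

/-- Rescaled realisation `Φ ↦ c•Φ`: `Φ^* ↦ c•Φ^*`, `(Φ^∨)^* ↦ c•(Φ^∨)^*`. -/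
def DRTransport.rescale (c : F) : DRTransport F ΩB ΩBd ΩW ΩWd where
  Φstar := c • D.Φstar
  Φdstar := c • D.Φdstar
  HB := D.HB
  HW := D.HW
  adjDR := by
    intro α β
    simp only [LinearMap.smul_apply, map_smul, LinearMap.smul_apply, smul_eq_mul, D.adjDR]

/-- Gauge invariance of the transported period constant: for `Φ ↦ c•Φ` the transported `ω₋`
is `c⁻¹•ω₋` and the constant is unchanged. -/
theorem periodConstant_gauge (c : F) (hc : c ≠ 0) (ωW : ΩW) (ωWd : ΩWd) (ωm : ΩBd)
    (hm : D.Φdstar ωm = ωWd) :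
    (D.rescale c).HB ((D.rescale c).Φstar ωW) (c⁻¹ • ωm) = D.HW ωW ωWd := by
  have hm' : (D.rescale c).Φdstar (c⁻¹ • ωm) = ωWd := by
    show (c • D.Φdstar) (c⁻¹ • ωm) = ωWd
    rw [LinearMap.smul_apply, map_smul, smul_smul, mul_inv_cancel₀ hc, one_smul, hm]
  exact periodConstant_transport (D.rescale c) ωW ωWd (c⁻¹ • ωm) hm'

end Hodge

/-! ## §C  Integer bookkeeping in the transported gauge (`v₂`-currency)

Columns (k2-g18/k2-g19/k3-g19 notation): `b d = [2 ∣ d] ∈ {0,1}` the depth bit, `n_v = 2 + b`,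
`γ₀, γ₁` the twin's interpolation intercept / Gauss slope, `s` the absolute Haar digit of k2-g9
(`v₂ κ_abs`, with the `√7`'s), `ρ` the in-range period-ratio residue (rows 49/51, R133).
The covolume column of the minimal twist is `cov(W_d) = cov(cm7)/(4|d|)`, i.e. `v₂`-digit
`-3 - b d` relative to `Ω₀²` (`cov(cm7) = Ω₀²·√7/2`, `v₂(√7/2)= -1`, `v₂ 4 = 2`).
-/

section Ledger

/-- depth of the key: `n_v = 2 + [2 ∣ d]`. -/
def nv (b : ℤ) : ℤ := 2 + b

/-- Covolume digit of `(W_d, ω_{W_d})` relative to `Ω₀²`:  `v₂(√7/2) - v₂(4|d|) = -1 - 2 - b`. -/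
def covDigit (b : ℤ) : ℤ := -3 - b

/-- The real-period digit of the minimal twist, `Ω_{W_d} = Ω₀^{±}/(2√|d|)` (Pal 2012 / k2-g18 P2),
in `2v₂`-currency: `2·v₂ Ω_W = -2 - b` (relative to `Ω₀`). -/
def twoOmegaDigit (b : ℤ) : ℤ := -2 - b

/-- MASTER LEDGER (transported gauge, `e = 2v₂Q` currency): `val ∝ |d|·8/(κ√7 Ω₀²)` from
`1/C_ι^{tr}` and `Q = val·Ω_W·ĥ/(L′·log²)`; hence
`e_A = -2·covDigit + twoOmegaDigit·1 … ` — we only record the `d`-dependence and the named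
constants: `e_A b = 6 + b - (γ₀ + γ₁·n_v b) - s - 2ρ`. -/
def eA (γ₀ γ₁ s ρ b : ℤ) : ℤ := 6 + b - (γ₀ + γ₁ * nv b) - s - 2 * ρ

/-- KEY-FREENESS is manifest once `γ₁ = 1` (k2-g19): the depth bit cancels between the
covolume column and the twin's Gauss digit. -/
theorem eA_keyFree_of_gamma1 (γ₀ s ρ b : ℤ) : eA γ₀ 1 s ρ b = 4 - γ₀ - s - 2 * ρ := by
  unfold eA nv; ring

/-- Conversely the slope in `b` is exactly `1 - γ₁` (k2-g18's depth-affine law, re-derived in the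
transported gauge: the `+b` now comes from `|d|` in the covolume, not from `(ω_{cm7}/ω_W)²`). -/
theorem eA_slope (γ₀ γ₁ s ρ : ℤ) : eA γ₀ γ₁ s ρ 1 - eA γ₀ γ₁ s ρ 0 = 1 - γ₁ := by
  unfold eA nv; ring

/-- SEAM ONCE.  Booking the twist seam in the log column (cm7-gauge logs: `+n_v`, k2-g18) with the
cm7 covolume, or in the covolume column (W-gauge logs: `0`) with `cov(W_d)`, gives the same total;
booking it in BOTH shifts the ledger by the depth `n_v` (the R124-type trap). -/
theorem seam_once (b L₀ C₀ : ℤ) :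
    (L₀ + nv b) + C₀ = L₀ + (C₀ + nv b) ∧
    ((L₀ + nv b) + (C₀ + nv b)) - (L₀ + (C₀ + nv b)) = nv b := by
  constructor <;> ring

/-- k3-g19's acceptance test `R140 + a₀ - γ₀ = 4` with R140 now a UNIVERSAL constant `r`
(this card: `r = 1 - s`, `d`-free and `ξ`-free) is a TWO-term test. -/
theorem acceptance_two_term (r a₀ γ₀ s : ℤ) (hr : r = 1 - s) :
    (r + a₀ - γ₀ = 4 ↔ a₀ - γ₀ = 3 + s) := by
  subst hr; constructor <;> intro h <;> linarith

/-- One-sided (LOWER) version: `α ≥ -1 ⟺ a₀ - γ₀ ≥ 2 + s`. -/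
theorem acceptance_two_term_lower (r a₀ γ₀ s : ℤ) (hr : r = 1 - s) :
    (r + a₀ - γ₀ ≥ 3 ↔ a₀ - γ₀ ≥ 2 + s) := by
  subst hr; constructor <;> intro h <;> linarith

/-- ELEMENTARY CONSTANTS CANCEL.  YZZ Thm 1.2's `c_GZ = ζ(2)/(4 L(1,η)²) = 7/24` (k2-g18: `-3`)
and LZZ Thm 3.8's `2^{g-3} δ_E^{1/2} ζ_F(2)/L(1,η)² = √7 · 7/24` enter `val` as a RATIO:
`c_GZ / c_{3.8} = 1/(4·2^{g-3}·δ_E^{1/2}) = 2^{1-g}·7^{-1/2}`, a 2-adic unit for `g = [F:ℚ] = 1`.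
So `-3` (booked) is matched by `+3` inside `a₀`.  Rational skeleton: -/
theorem v2_cGZ : padicValRat 2 (7 / 24 : ℚ) = -3 := by
  have h24 : padicValNat 2 24 = 3 := by
    rw [show (24 : ℕ) = 2 ^ 3 * 3 by norm_num, padicValNat.mul (by norm_num) (by norm_num),
      padicValNat.prime_pow, padicValNat.eq_zero_of_not_dvd (by norm_num)]
  have h7 : padicValNat 2 7 = 0 := padicValNat.eq_zero_of_not_dvd (by norm_num)
  rw [show (7 / 24 : ℚ) = ((7 : ℕ) : ℚ) / ((24 : ℕ) : ℚ) by norm_num,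
    padicValRat.div (by norm_num) (by norm_num), padicValRat.of_nat, padicValRat.of_nat, h24, h7]
  norm_num

/-- The rational part of `c_GZ/c_{3.8}`: `1/(4·2^{g-3}) = 2^{1-g}`, `= 1` at `g = 1`. -/
theorem elementary_ratio (g : ℤ) : (1 : ℚ) / (4 * 2 ^ (g - 3)) = 2 ^ (1 - g) := by
  rw [show (4 : ℚ) = 2 ^ (2 : ℤ) by norm_num, ← zpow_add₀ (by norm_num : (2:ℚ) ≠ 0),
      one_div, ← zpow_neg]
  congr 1; ring

theorem elementary_ratio_g_one : (1 : ℚ) / (4 * 2 ^ ((1 : ℤ) - 3)) = 1 := by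
  rw [elementary_ratio]; norm_num

/-- `7` is a 2-adic unit and `√7` has valuation `0` in `ℚ₂(√7)`; we record the rational shadow
`v₂ 7 = 0`, so `c_GZ/c_{3.8} = 2^{1-g}/√7` has `v₂ = 1 - g = 0`. -/
theorem v2_seven : padicValRat 2 (7 : ℚ) = 0 := by
  rw [show (7 : ℚ) = ((7 : ℕ) : ℚ) by norm_num, padicValRat.of_nat,
    padicValNat.eq_zero_of_not_dvd (by norm_num)]
  norm_num

/-- IMPRIMITIVITY TRAP (R124 hygiene): if the comparison function `u` is booked against
`𝔤`-DEPLETED Katz values (`𝔤 ⊇ cond ξ`), both `u(χ′_d)` and `Ka(χ′_d)` acquire the same Euler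
digits `E_ξ(W_d)` at `q ∣ N(ξ)` — fake odd-place digits (K17) that cancel in `val`. -/
theorem euler_digits_cancel {K : Type*} [Field K] (val u E : K) (hE : E ≠ 0) (hu : u ≠ 0) :
    (val * u * E) / (u * E) = val := by
  field_simp

end Ledger

/-! ## §D  The structural consequence, as a one-line schema

After transport, NOTHING of the good pair `(ξ, A_ξ, Φ)` and NO Mordell–Weil object enters the
constant: `(a-norm)`'s residual `a₀` is the valuation of the in-range comparison function
`u^{tr} = ⟨Φ^*ω_W ⊗ ω₋^{tr}, 𝓛(A_ξ)⟩ / (Ka · Kb)` — a ratio of two INTERPOLATION formulas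
(LZZ Thm 3.8 with `C_ι^{tr} = κΓ_k cov(W_d)`, vs. Katz/de Shalit II.4.14), the print template
being BDP-PJM Thm 2.13.  The schema below only records that a quantity equal on a set to a
`d`-free function of `ξ` and, for each `d`, independent of the admissible `ξ`, is constant on any
two keys sharing an admissible `ξ` (uniform good pairs, Rohrlich). -/

section Schema

/-- If `a d ξ = f ξ` whenever `ξ` is admissible for `d` (d-free given ξ), and `a d ξ` does not
depend on the admissible `ξ` (ξ-free given d: `val` is intrinsic), then two keys that share ONE
admissible `ξ` have the same residual. -/
theorem residual_constant {D Ξ : Type*} (adm : D → Ξ → Prop) (a : D → Ξ → ℤ) (f : Ξ → ℤ)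
    (hdfree : ∀ d ξ, adm d ξ → a d ξ = f ξ)
    (d₁ d₂ : D) (ξ₁ ξ₂ ξ₀ : Ξ) (h₀₁ : adm d₁ ξ₀) (h₀₂ : adm d₂ ξ₀)
    (hξfree₁ : a d₁ ξ₁ = a d₁ ξ₀) (hξfree₂ : a d₂ ξ₂ = a d₂ ξ₀) :
    a d₁ ξ₁ = a d₂ ξ₂ := by
  rw [hξfree₁, hξfree₂, hdfree _ _ h₀₁, hdfree _ _ h₀₂]

/-- Cofinite admissibility (Rohrlich-type non-vanishing for almost all `ξ` in an infinite family)
gives a common admissible `ξ₀` for any two keys. -/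
theorem exists_common_admissible {D Ξ : Type*} [Infinite Ξ] (adm : D → Ξ → Prop)
    (hcof : ∀ d, {ξ | ¬ adm d ξ}.Finite) (d₁ d₂ : D) : ∃ ξ₀, adm d₁ ξ₀ ∧ adm d₂ ξ₀ := by
  have hfin : ({ξ | ¬ adm d₁ ξ} ∪ {ξ | ¬ adm d₂ ξ}).Finite := (hcof d₁).union (hcof d₂)
  obtain ⟨ξ₀, hξ₀⟩ := hfin.infinite_compl.nonempty
  simp only [Set.mem_compl_iff, Set.mem_union, Set.mem_setOf_eq, not_or, not_not] at hξ₀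
  exact ⟨ξ₀, hξ₀.1, hξ₀.2⟩

end Schema

end Summit.BirchSwinnertonDyer.BirchSwinnertonDyer.Cruxes.SplitBadTwoLowerHalfOfFacts.StubIdeasK2G20
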